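import Mathlib.Data.Fintype.BigOperators
import Mathlib.Algebra.Order.BigOperators.Group.Finset
import Mathlib.Data.Fin.Tuple.Basic
import Mathlib.Tactic.Ring
import Mathlib.Tactic.GCongr
import Mathlib.Tactic.Linarith
import HarnessLib

/-!
# Moments of a symmetric pair count versus matchings: `#E ^ k ≤ M_k + 2k² #E^{k-1} · maxdeg`
# (`LambertianContactSwap.LambertianEuler`, stmt-AtomisticToContinuum-11854, line `Sketch`; lead c10,
# wave 1, piece W1 `card_pow_le_card_matchings_add` — the pathwise combinatorics of the `k`-th moment
# of the shell-pair count)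

Support file (`--supports stmt-AtomisticToContinuum-11854`).  Purely finite combinatorics (no measure
theory, no geometry).  Let `E ⊆ Fin n × Fin n` be a SYMMETRIC finite set of ordered pairs
(`p ∈ E → p.swap ∈ E`; the irreflexivity hypothesis of the registered statement is carried but not
needed), `F = #E`, `deg a = #{p ∈ E | p.1 = a}`, `D = max_a deg a` (`Finset.univ.sup`), and for `k : ℕ`
let `M_k` be the number of ordered `k`-tuples `t : Fin k → Fin n × Fin n` of pairs of `E` that are
pairwise VERTEX-DISJOINT (`Disjoint {(t l).1, (t l).2} {(t l').1, (t l').2}` for `l ≠ l'`).  Then for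
every `k ≥ 1`

  `F ^ k ≤ M_k + 2 k² F^{k-1} D`        (`card_pow_le_card_matchings_add`).

In the application (lead c10's DESIGN, step (P2)) `E` is the set of ordered shell-close pairs of
particles of a hard-sphere configuration, `F` the shell-pair count, and the inequality splits the
`k`-th moment `E[F^k]` into the matching term (which factorises under the free law) and a degree
correction `2k² E[F^{k-1} maxdeg]`.

## Proof

* degrees (`card_filter_snd_le_sup`, `card_filter_touch_le`): by the symmetry `p ↦ p.swap` the
  in-degree `#{p ∈ E | p.2 = a}` is also `≤ D`, hence the number of pairs of `E` with an endpoint in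
  a vertex set `V` is `≤ 2 · #V · D`;
* recursion (`card_matchings_mul_sub_le`): `M_k · (F - 4kD) ≤ M_{k+1}` — a `k`-matching `t` covers
  `≤ 2k` vertices, so at least `F - 4kD` pairs `e ∈ E` are vertex-disjoint from it, and
  `(t, e) ↦ Fin.cons e t` is injective into the `(k+1)`-matchings (`Finset.card_sigma`,
  `Finset.card_le_card_of_injOn`);
* trivial bounds (`card_matchings_le_pow`, `one_le_card_matchings_zero`): `M_k ≤ F^k`
  (`Fintype.card_piFinset_const`) and `1 ≤ M_0` (the empty tuple);
* induction on `k` from `k = 0` (`card_pow_le_aux`, arithmetic in `pow_succ_le_of_rec`):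
  `F^{k+1} ≤ F·M_k + 2k² F^k D ≤ M_{k+1} + 4kD·M_k + 2k² F^k D ≤ M_{k+1} + (2k² + 4k) F^k D`
  and `2k² + 4k ≤ 2(k+1)²`.

References: the standard matching/star decomposition of moments of pair counts (`U`-statistics),
e.g. Janson–Łuczak–Ruciński, *Random Graphs*, §6.1; all statements [folklore].
-/

noncomputable section

namespace Summit.AtomisticToContinuum.HydrodynamicLimit.Theorems.LambertianContactSwapLambertianEulerPairGraphMoments

open Finset

variable {n : ℕ}

/-! ## Degrees: in-degree versus out-degree, pairs touching a vertex set -/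

/-- By the symmetry `p ↦ p.swap` of `E`, the in-degree `#{p ∈ E | p.2 = a}` of a vertex is at most the
maximal out-degree `D = max_a #{p ∈ E | p.1 = a}`. [folklore] -/
theorem card_filter_snd_le_sup (E : Finset (Fin n × Fin n)) (hsym : ∀ p ∈ E, p.swap ∈ E)
    (a : Fin n) :
    (E.filter (fun p => p.2 = a)).card ≤
      Finset.univ.sup (fun a => (E.filter (fun p => p.1 = a)).card) := by
  calc (E.filter (fun p => p.2 = a)).card
      ≤ (E.filter (fun p => p.1 = a)).card := by
        refine Finset.card_le_card_of_injOn Prod.swap (fun p hp => ?_) (fun p _ q _ h => ?_)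
        · have hp' := Finset.mem_filter.1 (Finset.mem_coe.1 hp)
          exact Finset.mem_coe.2 (Finset.mem_filter.2 ⟨hsym p hp'.1, hp'.2⟩)
        · exact Prod.swap_injective h
    _ ≤ Finset.univ.sup (fun a => (E.filter (fun p => p.1 = a)).card) :=
        Finset.le_sup (f := fun a => (E.filter (fun p => p.1 = a)).card) (Finset.mem_univ a)

/-- The number of ordered pairs of a symmetric `E` with an endpoint in a vertex set `V` is at most
`2 · #V · D`, `D` the maximal out-degree. [folklore] -/
theorem card_filter_touch_le (E : Finset (Fin n × Fin n)) (hsym : ∀ p ∈ E, p.swap ∈ E)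
    (V : Finset (Fin n)) :
    (E.filter (fun p => p.1 ∈ V ∨ p.2 ∈ V)).card ≤
      2 * V.card * Finset.univ.sup (fun a => (E.filter (fun p => p.1 = a)).card) := by
  set D := Finset.univ.sup (fun a => (E.filter (fun p => p.1 = a)).card)
  have hdeg1 : ∀ a, (E.filter (fun p => p.1 = a)).card ≤ D := fun a =>
    Finset.le_sup (f := fun a => (E.filter (fun p => p.1 = a)).card) (Finset.mem_univ a)
  have hdeg2 : ∀ a, (E.filter (fun p => p.2 = a)).card ≤ D := fun a =>
    card_filter_snd_le_sup E hsym a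
  have h1 : (E.filter (fun p => p.1 ∈ V)).card ≤ V.card * D := by
    calc (E.filter (fun p => p.1 ∈ V)).card
        ≤ (V.biUnion (fun a => E.filter (fun p => p.1 = a))).card := by
          refine Finset.card_le_card (fun p hp => ?_)
          rw [Finset.mem_filter] at hp
          exact Finset.mem_biUnion.2 ⟨p.1, hp.2, Finset.mem_filter.2 ⟨hp.1, rfl⟩⟩
      _ ≤ ∑ a ∈ V, (E.filter (fun p => p.1 = a)).card := Finset.card_biUnion_le
      _ ≤ ∑ _a ∈ V, D := Finset.sum_le_sum (fun a _ => hdeg1 a)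
      _ = V.card * D := Finset.sum_const_nat (fun _ _ => rfl)
  have h2 : (E.filter (fun p => p.2 ∈ V)).card ≤ V.card * D := by
    calc (E.filter (fun p => p.2 ∈ V)).card
        ≤ (V.biUnion (fun a => E.filter (fun p => p.2 = a))).card := by
          refine Finset.card_le_card (fun p hp => ?_)
          rw [Finset.mem_filter] at hp
          exact Finset.mem_biUnion.2 ⟨p.2, hp.2, Finset.mem_filter.2 ⟨hp.1, rfl⟩⟩
      _ ≤ ∑ a ∈ V, (E.filter (fun p => p.2 = a)).card := Finset.card_biUnion_le
      _ ≤ ∑ _a ∈ V, D := Finset.sum_le_sum (fun a _ => hdeg2 a)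
      _ = V.card * D := Finset.sum_const_nat (fun _ _ => rfl)
  calc (E.filter (fun p => p.1 ∈ V ∨ p.2 ∈ V)).card
      ≤ (E.filter (fun p => p.1 ∈ V) ∪ E.filter (fun p => p.2 ∈ V)).card := by
        refine Finset.card_le_card (fun p hp => ?_)
        rw [Finset.mem_filter] at hp
        rw [Finset.mem_union, Finset.mem_filter, Finset.mem_filter]
        exact hp.2.imp (fun h => ⟨hp.1, h⟩) (fun h => ⟨hp.1, h⟩)
    _ ≤ (E.filter (fun p => p.1 ∈ V)).card + (E.filter (fun p => p.2 ∈ V)).card :=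
        Finset.card_union_le _ _
    _ ≤ V.card * D + V.card * D := Nat.add_le_add h1 h2
    _ = 2 * V.card * D := by ring

/-! ## Matchings: trivial bounds and the recursion `M_k · (F - 4kD) ≤ M_{k+1}` -/

/-- Trivial bound: the number `M_k` of ordered `k`-matchings of `E` is at most `#E ^ k`. [folklore] -/
theorem card_matchings_le_pow (E : Finset (Fin n × Fin n)) (k : ℕ) :
    ((Finset.univ : Finset (Fin k → Fin n × Fin n)).filter (fun t => (∀ l, t l ∈ E) ∧
        ∀ l l', l ≠ l' → Disjoint ({(t l).1, (t l).2} : Finset (Fin n)) {(t l').1, (t l').2})).card ≤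
      E.card ^ k := by
  calc _ ≤ (Fintype.piFinset (fun _ : Fin k => E)).card := by
        refine Finset.card_le_card (fun t ht => ?_)
        rw [Finset.mem_filter] at ht
        exact Fintype.mem_piFinset.2 ht.2.1
    _ = E.card ^ k := Fintype.card_piFinset_const E k

/-- The empty tuple is a `0`-matching: `1 ≤ M_0`. [folklore] -/
theorem one_le_card_matchings_zero (E : Finset (Fin n × Fin n)) :
    1 ≤ ((Finset.univ : Finset (Fin 0 → Fin n × Fin n)).filter (fun t => (∀ l, t l ∈ E) ∧
        ∀ l l', l ≠ l' → Disjoint ({(t l).1, (t l).2} : Finset (Fin n)) {(t l').1, (t l').2})).card :=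
  Finset.card_pos.2 ⟨fun l => l.elim0,
    Finset.mem_filter.2 ⟨Finset.mem_univ _, fun l => l.elim0, fun l => l.elim0⟩⟩

/-- **Recursion for matchings.**  `M_k · (#E - 4 k D) ≤ M_{k+1}`: a `k`-matching `t` covers at most
`2k` vertices, so (by `card_filter_touch_le`) at least `#E - 4kD` pairs of `E` are vertex-disjoint
from it, and prepending such a pair (`Fin.cons`) is injective into the `(k+1)`-matchings. [folklore] -/
theorem card_matchings_mul_sub_le (E : Finset (Fin n × Fin n)) (hsym : ∀ p ∈ E, p.swap ∈ E)
    (k : ℕ) :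
    ((Finset.univ : Finset (Fin k → Fin n × Fin n)).filter (fun t => (∀ l, t l ∈ E) ∧
        ∀ l l', l ≠ l' → Disjoint ({(t l).1, (t l).2} : Finset (Fin n)) {(t l').1, (t l').2})).card *
      (E.card - 4 * k * Finset.univ.sup (fun a => (E.filter (fun p => p.1 = a)).card)) ≤
    ((Finset.univ : Finset (Fin (k + 1) → Fin n × Fin n)).filter (fun t => (∀ l, t l ∈ E) ∧
        ∀ l l', l ≠ l' → Disjoint ({(t l).1, (t l).2} : Finset (Fin n)) {(t l').1, (t l').2})).card := by
  set D := Finset.univ.sup (fun a => (E.filter (fun p => p.1 = a)).card)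
  set G := (Finset.univ : Finset (Fin k → Fin n × Fin n)).filter (fun t => (∀ l, t l ∈ E) ∧
        ∀ l l', l ≠ l' → Disjoint ({(t l).1, (t l).2} : Finset (Fin n)) {(t l').1, (t l').2})
  set G' := (Finset.univ : Finset (Fin (k + 1) → Fin n × Fin n)).filter (fun t => (∀ l, t l ∈ E) ∧
        ∀ l l', l ≠ l' → Disjoint ({(t l).1, (t l).2} : Finset (Fin n)) {(t l').1, (t l').2})
  -- for every `k`-tuple `t`, at least `#E - 4kD` pairs of `E` avoid all the vertices of `t`
  have hA : ∀ t : Fin k → Fin n × Fin n, E.card - 4 * k * D ≤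
      (E.filter (fun e => ∀ l, Disjoint ({(t l).1, (t l).2} : Finset (Fin n)) {e.1, e.2})).card := by
    intro t
    -- the vertex set of `t`
    set V := (Finset.univ : Finset (Fin k)).biUnion (fun l => ({(t l).1, (t l).2} : Finset (Fin n)))
    have hV : V.card ≤ 2 * k := by
      calc V.card ≤ ∑ l : Fin k, ({(t l).1, (t l).2} : Finset (Fin n)).card := Finset.card_biUnion_le
        _ ≤ ∑ _l : Fin k, 2 := Finset.sum_le_sum (fun l _ => Finset.card_le_two)
        _ = 2 * k := by
          rw [Finset.sum_const_nat (fun _ _ => rfl), Finset.card_univ, Fintype.card_fin, mul_comm]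
    have hcover : E.card ≤
        (E.filter (fun e => ∀ l, Disjoint ({(t l).1, (t l).2} : Finset (Fin n)) {e.1, e.2})).card +
          (E.filter (fun p => p.1 ∈ V ∨ p.2 ∈ V)).card := by
      calc E.card
          ≤ (E.filter (fun e => ∀ l, Disjoint ({(t l).1, (t l).2} : Finset (Fin n)) {e.1, e.2}) ∪
              E.filter (fun p => p.1 ∈ V ∨ p.2 ∈ V)).card := by
            refine Finset.card_le_card (fun e he => ?_)
            rw [Finset.mem_union, Finset.mem_filter, Finset.mem_filter]
            by_cases h : ∀ l, Disjoint ({(t l).1, (t l).2} : Finset (Fin n)) {e.1, e.2}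
            · exact Or.inl ⟨he, h⟩
            · refine Or.inr ⟨he, ?_⟩
              obtain ⟨l, hl⟩ := not_forall.1 h
              obtain ⟨a, ha1, ha2⟩ := Finset.not_disjoint_iff.1 hl
              have haV : a ∈ V := Finset.mem_biUnion.2 ⟨l, Finset.mem_univ _, ha1⟩
              rw [Finset.mem_insert, Finset.mem_singleton] at ha2
              rcases ha2 with rfl | rfl
              · exact Or.inl haV
              · exact Or.inr haV
        _ ≤ _ := Finset.card_union_le _ _
    have htouch : (E.filter (fun p => p.1 ∈ V ∨ p.2 ∈ V)).card ≤ 4 * k * D := by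
      calc (E.filter (fun p => p.1 ∈ V ∨ p.2 ∈ V)).card ≤ 2 * V.card * D :=
            card_filter_touch_le E hsym V
        _ ≤ 2 * (2 * k) * D := Nat.mul_le_mul_right _ (Nat.mul_le_mul_left _ hV)
        _ = 4 * k * D := by ring
    omega
  calc G.card * (E.card - 4 * k * D)
      = ∑ _t ∈ G, (E.card - 4 * k * D) := (Finset.sum_const_nat (fun _ _ => rfl)).symm
    _ ≤ ∑ t ∈ G, (E.filter (fun e => ∀ l,
          Disjoint ({(t l).1, (t l).2} : Finset (Fin n)) {e.1, e.2})).card :=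
        Finset.sum_le_sum (fun t _ => hA t)
    _ = (G.sigma (fun t => E.filter (fun e => ∀ l,
          Disjoint ({(t l).1, (t l).2} : Finset (Fin n)) {e.1, e.2}))).card :=
        (Finset.card_sigma _ _).symm
    _ ≤ G'.card := by
        refine Finset.card_le_card_of_injOn
          (fun te : (Σ _ : Fin k → Fin n × Fin n, Fin n × Fin n) =>
            (Fin.cons te.2 te.1 : Fin (k + 1) → Fin n × Fin n))
          (fun te hte => ?_) (fun te _ te' _ h => ?_)
        · obtain ⟨ht, he⟩ := Finset.mem_sigma.1 (Finset.mem_coe.1 hte)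
          obtain ⟨-, ht1, ht2⟩ := Finset.mem_filter.1 ht
          obtain ⟨he, hdisj⟩ := Finset.mem_filter.1 he
          refine Finset.mem_coe.2 (Finset.mem_filter.2 ⟨Finset.mem_univ _, fun l => ?_,
            fun l l' hll' => ?_⟩)
          · rcases Fin.eq_zero_or_eq_succ l with rfl | ⟨i, rfl⟩
            · simp only [Fin.cons_zero]
              exact he
            · simp only [Fin.cons_succ]
              exact ht1 i
          · rcases Fin.eq_zero_or_eq_succ l with rfl | ⟨i, rfl⟩ <;>
              rcases Fin.eq_zero_or_eq_succ l' with rfl | ⟨j, rfl⟩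
            · exact absurd rfl hll'
            · simp only [Fin.cons_zero, Fin.cons_succ]
              exact (hdisj j).symm
            · simp only [Fin.cons_zero, Fin.cons_succ]
              exact hdisj i
            · simp only [Fin.cons_succ]
              exact ht2 i j fun hij => hll' (congrArg Fin.succ hij)
        · obtain ⟨t, e⟩ := te
          obtain ⟨t', e'⟩ := te'
          have h0 : e = e' := by simpa using congr_fun h 0
          have h1 : t = t' := funext fun i => by simpa using congr_fun h i.succ
          subst h0 h1
          rfl

/-! ## The moment inequality -/

/-- The arithmetic of the induction step: from `F^k ≤ M + 2k² F^{k-1} D`, `M (F - 4kD) ≤ M'` and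
`M ≤ F^k` conclude `F^{k+1} ≤ M' + 2(k+1)² F^k D`. [folklore] -/
theorem pow_succ_le_of_rec {F D M M' k : ℕ} (ih : F ^ k ≤ M + 2 * k ^ 2 * F ^ (k - 1) * D)
    (hrec : M * (F - 4 * k * D) ≤ M') (htriv : M ≤ F ^ k) :
    F ^ (k + 1) ≤ M' + 2 * (k + 1) ^ 2 * F ^ (k + 1 - 1) * D := by
  have h1 : F * M ≤ M' + 4 * k * D * F ^ k := by
    calc F * M ≤ ((F - 4 * k * D) + 4 * k * D) * M := Nat.mul_le_mul_right _ le_tsub_add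
      _ = M * (F - 4 * k * D) + 4 * k * D * M := by ring
      _ ≤ M' + 4 * k * D * F ^ k := Nat.add_le_add hrec (Nat.mul_le_mul_left _ htriv)
  have h2 : F * (2 * k ^ 2 * F ^ (k - 1) * D) ≤ 2 * k ^ 2 * F ^ k * D := by
    cases k with
    | zero => simp
    | succ j =>
      rw [Nat.add_sub_cancel]
      exact le_of_eq (by ring)
  have h3 : 4 * k + 2 * k ^ 2 ≤ 2 * (k + 1) ^ 2 := by
    ring_nf
    omega
  calc F ^ (k + 1) = F * F ^ k := pow_succ' F k
    _ ≤ F * (M + 2 * k ^ 2 * F ^ (k - 1) * D) := Nat.mul_le_mul_left _ ih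
    _ = F * M + F * (2 * k ^ 2 * F ^ (k - 1) * D) := mul_add _ _ _
    _ ≤ (M' + 4 * k * D * F ^ k) + 2 * k ^ 2 * F ^ k * D := Nat.add_le_add h1 h2
    _ = M' + (4 * k + 2 * k ^ 2) * (F ^ k * D) := by ring
    _ ≤ M' + (2 * (k + 1) ^ 2) * (F ^ k * D) :=
        Nat.add_le_add_left (Nat.mul_le_mul_right _ h3) _
    _ = M' + 2 * (k + 1) ^ 2 * F ^ (k + 1 - 1) * D := by
        rw [Nat.add_sub_cancel]
        ring

/-- `F^k ≤ M_k + 2 k² F^{k-1} D` for ALL `k` (induction from `k = 0`, where `1 ≤ M_0`), for a symmetric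
set `E` of ordered pairs. [folklore] -/
theorem card_pow_le_aux (E : Finset (Fin n × Fin n)) (hsym : ∀ p ∈ E, p.swap ∈ E) (k : ℕ) :
    E.card ^ k ≤
      ((Finset.univ : Finset (Fin k → Fin n × Fin n)).filter (fun t => (∀ l, t l ∈ E) ∧
          ∀ l l', l ≠ l' → Disjoint ({(t l).1, (t l).2} : Finset (Fin n)) {(t l').1, (t l').2})).card +
        2 * k ^ 2 * E.card ^ (k - 1) * Finset.univ.sup (fun a => (E.filter (fun p => p.1 = a)).card) := by
  induction k with
  | zero =>
    rw [pow_zero]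
    exact (one_le_card_matchings_zero E).trans (Nat.le_add_right _ _)
  | succ k ih =>
    exact pow_succ_le_of_rec ih (card_matchings_mul_sub_le E hsym k) (card_matchings_le_pow E k)

/-- **Moments of a pair count versus matchings.**  For a symmetric irreflexive finite set `E` of
ordered pairs of `Fin n` (`F = #E`, `D` the maximal degree, `M_k` the number of ordered `k`-tuples
of pairwise vertex-disjoint pairs of `E`) and every `k ≥ 1`:
`F ^ k ≤ M_k + 2 k² F^{k-1} D`. [folklore] -/
theorem card_pow_le_card_matchings_add :
    ∀ (n : ℕ) (E : Finset (Fin n × Fin n)), (∀ p ∈ E, p.swap ∈ E) → (∀ p ∈ E, p.1 ≠ p.2) →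
      ∀ k : ℕ, 1 ≤ k →
        E.card ^ k ≤
          ((Finset.univ : Finset (Fin k → Fin n × Fin n)).filter (fun t => (∀ l, t l ∈ E) ∧
              ∀ l l', l ≠ l' → Disjoint ({(t l).1, (t l).2} : Finset (Fin n)) {(t l').1, (t l').2})).card +
            2 * k ^ 2 * E.card ^ (k - 1) * Finset.univ.sup (fun a => (E.filter (fun p => p.1 = a)).card) :=
  fun _ E hsym _ k _ => card_pow_le_aux E hsym k

end Summit.AtomisticToContinuum.HydrodynamicLimit.Theorems.LambertianContactSwapLambertianEulerPairGraphMoments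

end
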